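import Summits.QuantumFields.YangMills.Theorems.BalabanUVNodesN08AlphaAbelianWindow
import Literature.MathematicalPhysics.QuantumFieldTheory.Balaban1983to89.B4Block227

/-!
# Route «BalabanUVNodes», Track-A DAG node N08 = [Balaban1985UV3] — (α) clause, the in-edge sentence (b11‴) CONSTRUCTED, part 3:
# THE UNIVERSAL STAGGERED CURVATURE PATTERN OF ONE SCALE — half-shifted stripes of period `2M`, their tent sums `±(M²+1)/2`, and the
# upper-triangular potential realising them in every coordinate plane

Cell `pub-ymgap`, seat `pub-ymgap-dag-n08-d` gen 5, file F3 (over F2b `…N08AlphaAbelianWindow`).  `bears_on: R4∕N08`; filed `--supports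
stmt-QuantumFields-19910 --as helper`.  Sorry-free, standard axioms.

THE IDEA.  A scale-`j` plaquette `p′` of the history must see an averaged plaquette variable `|Ū^j(∂p′) − 1| ≥ g_jp(g_j)` while every FINE plaquette
under it is regular, `≤ ½C68·g_jp(g_j)·L^{−2j}`; by F2 ∕ F2b the averaged curvature at `p′ = (z; μ,ν)` is the TENT-weighted sum of the fine curvature over
the window (four corner blocks, `M = L^j`), of total weight `M²`.  A fine curvature of constant sign cannot be exact on the torus (total flux zero), and
the recorded plaquettes sit at arbitrary positions; the pattern that serves ALL positions at once is the HALF-SHIFTED STRIPE of period `2M`: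
`σ_M(t) = +1` on `[h, h+M) mod 2M`, `−1` elsewhere, `h = (M−1)/2` (`M` odd) — here DEFINED as the difference `σ_M = ΔS_M` of the explicit triangle wave
`S_M` (`triS`), so that window sums telescope.  RESULTS ([folklore] arithmetic):
* `abs_sig_le_one`, `abs_triS_le` (`|S_M| ≤ (M+1)/2`), periodicity `triS_add_two_mul`;
* ★ `abs_tent_sig`: `|Σ_{t,u<M} σ_M(Mb + t + u)| = (M² + 1)/2` for EVERY integer `b` (both parities: the half shift);
* the upper-triangular potential `patPot f M : (x, μ) ↦ −f·Σ_{ν>μ} S_M(x_ν)` on `ℤ^d`: ★ `curl_patPot` (`curl = f·σ_M(x_ν)` for `μ < ν` — stripes along the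
  larger index in every plane), `abs_curl_patPot_le` (`≤ |f|`), `abs_patPot_le` (`≤ |f|(d−1)(M+1)/2`), periodicity in every coordinate;
* with F2's `curl_linAvgIter_of_stripes`: ★ `abs_curl_linAvgIter_patPot` — the `j`-fold linear average of the scale-`j` pattern (`M = L^j`) has
  `|curl| = |f|·((L^j)² + 1)/2` at EVERY coarse plaquette `(z; μ,ν)`, `μ < ν`.
HONEST FRAMING: kernel arithmetic for TEST configurations; nothing of [B10] ∕ [7] ∕ [4]'s estimates asserted; count-neutral; NOT a discharge of N08.
-/

noncomputable section

namespace Summit.QuantumFields.YangMills.Theorems.BalabanUVNodesN08AlphaPattern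

open scoped BigOperators
open Literature.MathematicalPhysics.QuantumFieldTheory.Balaban1983to89
open B7Prop1Explicit
open Summit.QuantumFields.YangMills.Theorems.BalabanUVNodesN08AlphaAbelianLift
open Summit.QuantumFields.YangMills.Theorems.BalabanUVNodesN08AlphaAbelianAverage
open Summit.QuantumFields.YangMills.Theorems.BalabanUVNodesN08AlphaAbelianWindow

variable (M : ℕ)

/-! ## §1 The triangle wave `S_M` and the stripe `σ_M = ΔS_M` -/

/-- The residue of `t` modulo `2M`, in `[0, 2M)`. [folklore] -/
def res (t : ℤ) : ℤ := t % (2 * (M : ℤ))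

/-- **THE TRIANGLE WAVE `S_M`** of period `2M` (`h = ⌊M/2⌋`): `−w` on `[0,h]`, `w − 2h` on `[h, h+M]`, `2M − w` on `[h+M, 2M)`, `w = t mod 2M`.
[folklore] -/
def triS (t : ℤ) : ℝ :=
  if res M t ≤ (M / 2 : ℕ) then -(res M t : ℝ)
  else if res M t ≤ ((M / 2 : ℕ) : ℤ) + M then (res M t : ℝ) - 2 * ((M / 2 : ℕ) : ℝ)
  else 2 * (M : ℝ) - (res M t : ℝ)

/-- **THE HALF-SHIFTED STRIPE `σ_M := ΔS_M`**: `σ_M(t) = S_M(t+1) − S_M(t)` (`= +1` on `[h, h+M) mod 2M`, `−1` elsewhere). [folklore] -/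
def sig (t : ℤ) : ℝ := triS M (t + 1) - triS M t

variable {M}

/-- The residue lies in `[0, 2M)`. [folklore] -/
theorem res_nonneg_lt (hM : 1 ≤ M) (t : ℤ) : 0 ≤ res M t ∧ res M t < 2 * (M : ℤ) := by
  have h2 : (0 : ℤ) < 2 * (M : ℤ) := by omega
  exact ⟨Int.emod_nonneg _ h2.ne', Int.emod_lt_of_pos _ h2⟩

/-- Periodicity of the residue. [folklore] -/
theorem res_add_two_mul (t k : ℤ) : res M (t + 2 * (M : ℤ) * k) = res M t := by
  unfold res; rw [Int.add_mul_emod_self_left]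

/-- **Periodicity `S_M(t + 2Mk) = S_M(t)`.** [folklore] -/
theorem triS_add_two_mul (t k : ℤ) : triS M (t + 2 * (M : ℤ) * k) = triS M t := by
  unfold triS; rw [res_add_two_mul]

/-- Periodicity of `σ_M`. [folklore] -/
theorem sig_add_two_mul (t k : ℤ) : sig M (t + 2 * (M : ℤ) * k) = sig M t := by
  unfold sig; rw [show t + 2 * (M : ℤ) * k + 1 = (t + 1) + 2 * (M : ℤ) * k by ring, triS_add_two_mul, triS_add_two_mul]

/-- The residue of a representative. [folklore] -/
theorem res_of_lt {t : ℤ} (h0 : 0 ≤ t) (ht : t < 2 * (M : ℤ)) : res M t = t := Int.emod_eq_of_lt h0 ht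

/-- The successor residue. [folklore] -/
theorem res_succ (hM : 1 ≤ M) (t : ℤ) :
    res M (t + 1) = if res M t + 1 < 2 * (M : ℤ) then res M t + 1 else 0 := by
  have hr := res_nonneg_lt hM t
  have h1 : (1 : ℤ) % (2 * (M : ℤ)) = 1 := Int.emod_eq_of_lt (by norm_num) (by omega)
  have key : res M (t + 1) = (res M t + 1) % (2 * (M : ℤ)) := by unfold res; rw [Int.add_emod, h1]
  rw [key]
  split_ifs with h
  · exact Int.emod_eq_of_lt (by omega) h
  · have : res M t + 1 = 2 * (M : ℤ) := by omega
    rw [this, Int.emod_self]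

/-- Value of `S_M` on the first piece. [folklore] -/
theorem triS_eq₁ {t : ℤ} (h1 : res M t ≤ (M / 2 : ℕ)) : triS M t = -(res M t : ℝ) := by
  unfold triS; rw [if_pos h1]

/-- Value of `S_M` on the second piece. [folklore] -/
theorem triS_eq₂ {t : ℤ} (h1 : ¬ res M t ≤ (M / 2 : ℕ)) (h2 : res M t ≤ ((M / 2 : ℕ) : ℤ) + M) :
    triS M t = (res M t : ℝ) - 2 * ((M / 2 : ℕ) : ℝ) := by
  unfold triS; rw [if_neg h1, if_pos h2]

/-- Value of `S_M` on the third piece. [folklore] -/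
theorem triS_eq₃ {t : ℤ} (h1 : ¬ res M t ≤ (M / 2 : ℕ)) (h2 : ¬ res M t ≤ ((M / 2 : ℕ) : ℤ) + M) :
    triS M t = 2 * (M : ℝ) - (res M t : ℝ) := by
  unfold triS; rw [if_neg h1, if_neg h2]

/-- **`|σ_M| ≤ 1`** (indeed `σ_M ∈ {±1}` for odd `M`; `≤ 1` is what the regularity budget uses). [folklore] -/
theorem abs_sig_le_one (hM : Odd M) (t : ℤ) : |sig M t| ≤ 1 := by
  obtain ⟨h, hh⟩ := hM
  have hM1 : 1 ≤ M := by omega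
  have hdiv : M / 2 = h := by omega
  have hr := res_nonneg_lt hM1 t
  have hs := res_succ hM1 t
  have hMr : (M : ℝ) = 2 * h + 1 := by exact_mod_cast hh
  have hMz : (M : ℤ) = 2 * h + 1 := by exact_mod_cast hh
  rw [abs_le]
  unfold sig
  by_cases hA : res M t + 1 < 2 * (M : ℤ)
  · rw [if_pos hA] at hs
    have hsr : ((res M (t + 1) : ℤ) : ℝ) = (res M t : ℝ) + 1 := by rw [hs]; push_cast; ring
    by_cases c1 : res M (t + 1) ≤ (M / 2 : ℕ)
    · rw [triS_eq₁ c1, triS_eq₁ (by rw [hs] at c1; omega), hsr]; constructor <;> linarith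
    · by_cases c2 : res M t ≤ (M / 2 : ℕ)
      · have hw : (res M t : ℝ) = h := by rw [hdiv] at c2; rw [hs, hdiv] at c1; exact_mod_cast (show res M t = h by omega)
        rw [triS_eq₂ c1 (by rw [hs, hdiv]; omega), triS_eq₁ c2, hsr, hdiv, hw]; constructor <;> linarith
      · by_cases c3 : res M (t + 1) ≤ ((M / 2 : ℕ) : ℤ) + M
        · rw [triS_eq₂ c1 c3, triS_eq₂ c2 (by rw [hs] at c3; omega), hsr]; constructor <;> linarith
        · by_cases c4 : res M t ≤ ((M / 2 : ℕ) : ℤ) + M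
          · have hw : (res M t : ℝ) = h + M := by
              rw [hdiv] at c4; rw [hs, hdiv] at c3; exact_mod_cast (show res M t = h + M by omega)
            rw [triS_eq₃ c1 c3, triS_eq₂ c2 c4, hsr, hdiv, hw, hMr]; constructor <;> linarith
          · rw [triS_eq₃ c1 c3, triS_eq₃ c2 c4, hsr]; constructor <;> linarith
  · rw [if_neg hA] at hs
    have hw : res M t = 2 * M - 1 := by omega
    have hsr : ((res M (t + 1) : ℤ) : ℝ) = 0 := by rw [hs]; push_cast; ring
    have hwr : ((res M t : ℤ) : ℝ) = 2 * M - 1 := by rw [hw]; push_cast; ring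
    have c1 : res M (t + 1) ≤ (M / 2 : ℕ) := by rw [hs]; positivity
    have c2 : ¬ res M t ≤ (M / 2 : ℕ) := by rw [hw, hdiv]; omega
    by_cases c4 : res M t ≤ ((M / 2 : ℕ) : ℤ) + M
    · have h0 : h = 0 := by rw [hw, hdiv] at c4; omega
      have hM1r : (M : ℝ) = 1 := by rw [hMr]; simp [h0]
      rw [triS_eq₁ c1, triS_eq₂ c2 c4, hsr, hwr, hdiv, h0]; constructor <;> push_cast <;> linarith
    · rw [triS_eq₁ c1, triS_eq₃ c2 c4, hsr, hwr]; constructor <;> linarith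

/-- **`|S_M| ≤ (M+1)/2`.** [folklore] -/
theorem abs_triS_le (hM : Odd M) (t : ℤ) : |triS M t| ≤ ((M : ℝ) + 1) / 2 := by
  obtain ⟨h, hh⟩ := hM
  have hM1 : 1 ≤ M := by omega
  have hdiv : M / 2 = h := by omega
  have hr := res_nonneg_lt hM1 t
  have hMr : (M : ℝ) = 2 * h + 1 := by exact_mod_cast hh
  have hr0 : (0 : ℝ) ≤ (res M t : ℝ) := by exact_mod_cast hr.1
  have hr2 : (res M t : ℝ) < 2 * (M : ℝ) := by exact_mod_cast hr.2
  rw [abs_le]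
  by_cases c1 : res M t ≤ (M / 2 : ℕ)
  · have c1r : (res M t : ℝ) ≤ h := by rw [hdiv] at c1; exact_mod_cast c1
    rw [triS_eq₁ c1]; constructor <;> linarith
  · have c1r : (h : ℝ) < (res M t : ℝ) := by rw [hdiv] at c1; exact_mod_cast (lt_of_not_ge c1)
    by_cases c2 : res M t ≤ ((M / 2 : ℕ) : ℤ) + M
    · have c2r : (res M t : ℝ) ≤ h + M := by rw [hdiv] at c2; exact_mod_cast c2
      rw [triS_eq₂ c1 c2, hdiv]; constructor <;> linarith
    · have c2r : (h : ℝ) + M < (res M t : ℝ) := by rw [hdiv] at c2; exact_mod_cast (lt_of_not_ge c2)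
      rw [triS_eq₃ c1 c2]; constructor <;> linarith

/-! ## §2 Block sums of `S_M` and the tent sums of `σ_M` -/

/-- `Σ_{t<M} S_M(t) = −h²` (`M = 2h+1`). [folklore] -/
theorem sum_triS_block_even (hM : Odd M) : ∑ t ∈ Finset.range M, triS M (t : ℤ) = -(((M / 2 : ℕ) : ℝ) ^ 2) := by
  obtain ⟨h, hh⟩ := hM
  have hM1 : 1 ≤ M := by omega
  have hdiv : M / 2 = h := by omega
  have hM' : M = (h + 1) + h := by omega
  rw [hdiv, congrArg Finset.range hM', Finset.sum_range_add]
  have hA : ∑ t ∈ Finset.range (h + 1), triS M (t : ℤ) = ∑ t ∈ Finset.range (h + 1), (-(t : ℝ)) := by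
    refine Finset.sum_congr rfl fun t ht => ?_
    rw [Finset.mem_range] at ht
    have hres : res M (t : ℤ) = t := res_of_lt (by omega) (by omega)
    unfold triS; rw [hres, hdiv, if_pos (by omega)]; push_cast; ring
  have hB : ∑ t ∈ Finset.range h, triS M (((h + 1 + t : ℕ)) : ℤ) = ∑ t ∈ Finset.range h, ((t : ℝ) + 1 - h) := by
    refine Finset.sum_congr rfl fun t ht => ?_
    rw [Finset.mem_range] at ht
    have hres : res M ((h + 1 + t : ℕ) : ℤ) = (h + 1 + t : ℕ) := res_of_lt (by omega) (by omega)
    unfold triS; rw [hres, hdiv, if_neg (by omega), if_pos (by omega)]; push_cast; ring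
  rw [hA, hB, Finset.sum_neg_distrib, B4Block227.sum_range_id_real]
  rw [Finset.sum_sub_distrib, Finset.sum_add_distrib, B4Block227.sum_range_id_real, Finset.sum_const, Finset.card_range, Finset.sum_const,
    Finset.card_range, nsmul_eq_mul, nsmul_eq_mul]
  push_cast; ring

/-- `Σ_{t<M} S_M(M + t) = (h+1)²`. [folklore] -/
theorem sum_triS_block_odd (hM : Odd M) : ∑ t ∈ Finset.range M, triS M ((M : ℤ) + t) = (((M / 2 : ℕ) : ℝ) + 1) ^ 2 := by
  obtain ⟨h, hh⟩ := hM
  have hM1 : 1 ≤ M := by omega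
  have hdiv : M / 2 = h := by omega
  have hM' : M = (h + 1) + h := by omega
  rw [hdiv, congrArg Finset.range hM', Finset.sum_range_add]
  have hA : ∑ t ∈ Finset.range (h + 1), triS M ((M : ℤ) + t) = ∑ t ∈ Finset.range (h + 1), ((t : ℝ) + 1) := by
    refine Finset.sum_congr rfl fun t ht => ?_
    rw [Finset.mem_range] at ht
    have hres : res M ((M : ℤ) + t) = (M : ℤ) + t := res_of_lt (by omega) (by omega)
    unfold triS; rw [hres, hdiv, if_neg (by omega), if_pos (by omega)]; push_cast [hh]; ring
  have hB : ∑ t ∈ Finset.range h, triS M ((M : ℤ) + ((h + 1 + t : ℕ) : ℤ)) = ∑ t ∈ Finset.range h, ((h : ℝ) - t) := by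
    refine Finset.sum_congr rfl fun t ht => ?_
    rw [Finset.mem_range] at ht
    have hres : res M ((M : ℤ) + ((h + 1 + t : ℕ) : ℤ)) = (M : ℤ) + (h + 1 + t : ℕ) := res_of_lt (by omega) (by omega)
    unfold triS; rw [hres, hdiv, if_neg (by omega), if_neg (by omega)]; push_cast [hh]; ring
  rw [hA, hB, Finset.sum_add_distrib, B4Block227.sum_range_id_real, Finset.sum_sub_distrib, B4Block227.sum_range_id_real, Finset.sum_const, Finset.card_range,
    Finset.sum_const, Finset.card_range, nsmul_eq_mul, nsmul_eq_mul]
  push_cast; ring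

/-- Block sums at the periods: `Σ_{t<M} S_M(2Mk + t) = −h²`, `Σ_{t<M} S_M(2Mk + M + t) = (h+1)²`. [folklore] -/
theorem sum_triS_block (hM : Odd M) (k : ℤ) :
    ∑ t ∈ Finset.range M, triS M (2 * (M : ℤ) * k + t) = -(((M / 2 : ℕ) : ℝ) ^ 2) ∧
    ∑ t ∈ Finset.range M, triS M (2 * (M : ℤ) * k + M + t) = (((M / 2 : ℕ) : ℝ) + 1) ^ 2 := by
  constructor
  · rw [← sum_triS_block_even hM]
    exact Finset.sum_congr rfl fun t _ => by rw [show 2 * (M : ℤ) * k + t = t + 2 * (M : ℤ) * k by ring, triS_add_two_mul]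
  · rw [← sum_triS_block_odd hM]
    exact Finset.sum_congr rfl fun t _ => by rw [show 2 * (M : ℤ) * k + M + t = ((M : ℤ) + t) + 2 * (M : ℤ) * k by ring, triS_add_two_mul]

/-- Window sums of `σ_M = ΔS_M` telescope: `Σ_{u<M} σ_M(c + u) = S_M(c + M) − S_M(c)`. [folklore] -/
theorem sum_sig_window (c : ℤ) : ∑ u ∈ Finset.range M, sig M (c + u) = triS M (c + M) - triS M c := by
  have := Finset.sum_range_sub (fun u : ℕ => triS M (c + u)) M
  simp only [Nat.cast_zero, add_zero] at this
  rw [← this]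
  refine Finset.sum_congr rfl fun u _ => ?_
  simp only [sig, Nat.cast_succ, add_assoc]

/-- **★ THE TENT SUM OF THE HALF-SHIFTED STRIPE IS `±(M²+1)/2` AT EVERY INTEGER POSITION** (`M` odd): `|Σ_{t,u<M} σ_M(Mb + t + u)| = (M²+1)/2`.
[folklore] -/
theorem abs_tent_sig (hM : Odd M) (b : ℤ) : |tent M (sig M) b| = ((M : ℝ) ^ 2 + 1) / 2 := by
  have hh := hM
  obtain ⟨h, hMh⟩ := hh
  have hdiv : M / 2 = h := by omega
  have hMr : (M : ℝ) = 2 * h + 1 := by exact_mod_cast hMh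
  have htent : tent M (sig M) b = ∑ t ∈ Finset.range M, triS M ((M : ℤ) * (b + 1) + t) - ∑ t ∈ Finset.range M, triS M ((M : ℤ) * b + t) := by
    unfold tent
    rw [Finset.sum_range (fun t => triS M ((M : ℤ) * (b + 1) + t)), Finset.sum_range (fun t => triS M ((M : ℤ) * b + t)),
      ← Finset.sum_sub_distrib]
    refine Finset.sum_congr rfl fun t _ => ?_
    rw [← Finset.sum_range (fun u => sig M ((M : ℤ) * b + (t : ℕ) + u)), sum_sig_window]
    congr 2; ring
  rw [htent]
  obtain ⟨k, hk | hk⟩ := Int.even_or_odd' b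
  · -- `b = 2k`
    have h1 : ∑ t ∈ Finset.range M, triS M ((M : ℤ) * (b + 1) + t) = (((M / 2 : ℕ) : ℝ) + 1) ^ 2 := by
      rw [← (sum_triS_block hM k).2]; exact Finset.sum_congr rfl fun t _ => by rw [hk]; ring_nf
    have h2 : ∑ t ∈ Finset.range M, triS M ((M : ℤ) * b + t) = -(((M / 2 : ℕ) : ℝ) ^ 2) := by
      rw [← (sum_triS_block hM k).1]; exact Finset.sum_congr rfl fun t _ => by rw [hk]; ring_nf
    rw [h1, h2, hdiv]
    have hval : (((h : ℕ) : ℝ) + 1) ^ 2 - -(((h : ℕ) : ℝ) ^ 2) = ((M : ℝ) ^ 2 + 1) / 2 := by rw [hMr]; ring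
    rw [hval, abs_of_nonneg (by positivity)]
  · -- `b = 2k + 1`
    have h1 : ∑ t ∈ Finset.range M, triS M ((M : ℤ) * (b + 1) + t) = -(((M / 2 : ℕ) : ℝ) ^ 2) := by
      rw [← (sum_triS_block hM (k + 1)).1]; exact Finset.sum_congr rfl fun t _ => by rw [hk]; ring_nf
    have h2 : ∑ t ∈ Finset.range M, triS M ((M : ℤ) * b + t) = (((M / 2 : ℕ) : ℝ) + 1) ^ 2 := by
      rw [← (sum_triS_block hM k).2]; exact Finset.sum_congr rfl fun t _ => by rw [hk]; ring_nf
    rw [h1, h2, hdiv]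
    have hval : -(((h : ℕ) : ℝ) ^ 2) - (((h : ℕ) : ℝ) + 1) ^ 2 = -(((M : ℝ) ^ 2 + 1) / 2) := by rw [hMr]; ring
    rw [hval, abs_neg, abs_of_nonneg (by positivity)]

/-- Tents are linear: `tent M (c·g) = c·tent M g`. [folklore] -/
theorem tent_const_mul (c : ℝ) (g : ℤ → ℝ) (b : ℤ) : tent M (fun w => c * g w) b = c * tent M g b := by
  simp only [tent, Finset.mul_sum]

/-! ## §3 The upper-triangular potential on `ℤ^d` and its curvature -/

variable {d : ℕ} (M)

/-- **THE PATTERN POTENTIAL** of amplitude `f` and scale `M`: `patPot f M (x, μ) = −f·Σ_{ν > μ} S_M(x_ν)` (upper-triangular: each plane `(μ,ν)`,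
`μ < ν`, is striped along its larger index `ν`). [folklore] -/
def patPot (f : ℝ) (x : Site d) (μ : Fin d) : ℝ := -f * ∑ ν ∈ Finset.Ioi μ, triS M (x ν)

/-- **★ THE CURVATURE OF THE PATTERN**: `curl (patPot f M)(x; μ,ν) = f·σ_M(x_ν)` for `μ < ν`. [folklore] -/
theorem curl_patPot (f : ℝ) (x : Site d) {μ ν : Fin d} (hμν : μ < ν) : curl (patPot M f) x μ ν = f * sig M (x ν) := by
  unfold curl patPot
  -- the `ν`-component terms cancel: `x + e_μ` and `x` agree on every coordinate `> ν > μ`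
  have hν : ∑ l ∈ Finset.Ioi ν, triS M ((x + e μ) l) = ∑ l ∈ Finset.Ioi ν, triS M (x l) := by
    refine Finset.sum_congr rfl fun l hl => ?_
    rw [Finset.mem_Ioi] at hl
    rw [Pi.add_apply, e_apply, if_neg (by intro h'; subst h'; exact lt_asymm hμν hl), add_zero]
  -- the `μ`-component terms differ only at `l = ν`
  have hμ : ∑ l ∈ Finset.Ioi μ, triS M ((x + e ν) l) - ∑ l ∈ Finset.Ioi μ, triS M (x l) = triS M (x ν + 1) - triS M (x ν) := by
    rw [← Finset.sum_sub_distrib, Finset.sum_eq_single ν]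
    · rw [Pi.add_apply, e_apply, if_pos rfl]
    · intro l _ hl
      rw [Pi.add_apply, e_apply, if_neg hl, add_zero, sub_self]
    · intro h'; exact absurd (Finset.mem_Ioi.2 hμν) h'
  rw [hν, sig]
  linear_combination f * hμ

/-- `|curl (patPot f M)| ≤ |f|` at every plaquette (odd `M`). [folklore] -/
theorem abs_curl_patPot_le (hM : Odd M) (f : ℝ) (x : Site d) (μ ν : Fin d) : |curl (patPot M f) x μ ν| ≤ |f| := by
  rcases lt_trichotomy μ ν with h | rfl | h
  · rw [curl_patPot M f x h, abs_mul]
    exact mul_le_of_le_one_right (abs_nonneg f) (abs_sig_le_one hM _)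
  · rw [curl_self, abs_zero]; exact abs_nonneg f
  · rw [curl_swap, abs_neg, curl_patPot M f x h, abs_mul]
    exact mul_le_of_le_one_right (abs_nonneg f) (abs_sig_le_one hM _)

/-- `|patPot f M (x, μ)| ≤ |f|·(d−1)·(M+1)/2` (odd `M`). [folklore] -/
theorem abs_patPot_le (hM : Odd M) (f : ℝ) (x : Site d) (μ : Fin d) : |patPot M f x μ| ≤ |f| * ((d : ℝ) - 1) * (((M : ℝ) + 1) / 2) := by
  unfold patPot
  rw [abs_mul, abs_neg, mul_assoc]
  refine mul_le_mul_of_nonneg_left ?_ (abs_nonneg f)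
  refine (Finset.abs_sum_le_sum_abs _ _).trans ?_
  refine (Finset.sum_le_sum fun ν _ => abs_triS_le hM (x ν)).trans ?_
  rw [Finset.sum_const, nsmul_eq_mul, Fin.card_Ioi]
  have hμd : (μ : ℕ) < d := μ.isLt
  have : ((d - 1 - (μ : ℕ) : ℕ) : ℝ) ≤ (d : ℝ) - 1 := by
    rw [Nat.cast_sub (by omega), Nat.cast_sub (by omega)]; push_cast; linarith [(Nat.cast_nonneg (μ : ℕ) : (0 : ℝ) ≤ _)]
  have hpos : (0 : ℝ) ≤ ((M : ℝ) + 1) / 2 := by positivity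
  nlinarith

/-- **Periodicity of the potential in every coordinate**: `patPot f M (x + 2Mk·e_i, μ) = patPot f M (x, μ)`. [folklore] -/
theorem patPot_add_period (f : ℝ) (x : Site d) (i : Fin d) (k : ℤ) (μ : Fin d) :
    patPot M f (x + (2 * (M : ℤ) * k) • e i) μ = patPot M f x μ := by
  unfold patPot
  congr 1
  refine Finset.sum_congr rfl fun ν _ => ?_
  rw [Pi.add_apply, Pi.smul_apply, e_apply, smul_eq_mul]
  split_ifs
  · rw [mul_one, triS_add_two_mul]
  · rw [mul_zero, add_zero]

/-! ## §4 The `j`-fold average of the scale-`j` pattern: `|curl| = |f|·((L^j)²+1)/2` at every coarse plaquette -/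

/-- **★ THE SCALE-`j` PATTERN SEEN BY THE `j`-FOLD LINEAR AVERAGE**: for `M = L^j` (`L` odd, `d ≥ 1`) and `μ < ν`,
`|curl (linAvgIter L (patPot f (L^j)) j)(z; μ,ν)| = |f|·((L^j)² + 1)/2` at EVERY `z`. [folklore] -/
theorem abs_curl_linAvgIter_patPot {L : ℕ} (hL : Odd L) (hL1 : 1 ≤ L) (hd : 1 ≤ d) (f : ℝ) (j : ℕ) (z : Site d) {μ ν : Fin d} (hμν : μ < ν) :
    |curl (linAvgIter L (patPot (L ^ j) f) j) z μ ν| = |f| * ((((L : ℝ) ^ j) ^ 2 + 1) / 2) := by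
  have hstr := curl_linAvgIter_of_stripes L hL1 hd (a := patPot (L ^ j) f) (ne_of_lt hμν) (Or.inr rfl) (f := fun w => f * sig (L ^ j) w)
    (fun x => curl_patPot (L ^ j) f x hμν) j z
  rw [hstr, tent_const_mul, abs_mul, abs_tent_sig (hL.pow)]
  push_cast; ring

end Summit.QuantumFields.YangMills.Theorems.BalabanUVNodesN08AlphaPattern

end
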